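import Summits.BirchSwinnertonDyer.BirchSwinnertonDyer.Theorems.KolyvaginRoadThreeZhangSupplySignedOfJump
import HarnessLib

/-!
# Route `KolyvaginRoadThree`, deciding crux `ZhangSharpFrameAtThreeHL` (item stmt-BirchSwinnertonDyer-19574):
# the SIGNED supply from the unsigned jump — the USABLE form: ordinary isotropy asked only above GOOD
# unipotent-admissible primes
# (cell `bsd-stepL`, ACCEL seat `bsd-stepL-koly3b` g5; `--supports stmt-BirchSwinnertonDyer-19574`, helper; part IX-b of
# the `KolyvaginRoadThreeZhangSupply*` series, companion of `…ZhangSupplySignedOfJump` (part IX, p505194))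

HONEST FRAMING. One theorem; 0 definitions, 0 named facts, 0 `sorry`; CONDITIONAL on every binder; closes nothing (T7).
PARTITION: O2@3 (B10) × A1 × crux 19574 × the S2-ENGINE's (Supply) binder — proves-glue.

WHY. Part IX's `supply_signed_of_jump` copied the binder `hisoOrd` of the capstone p502470 VERBATIM — isotropy of the
ORDINARY condition at EVERY finite place. zhang3-p1 g9 (STATUS 06:16:50Z) observed that this binder is unsatisfiable
together with (Perf): at a place with trivial Frobenius on `E[3]` (every Kolyvagin `λ`, every non-good
unipotent-admissible `q`) `ordinaryLocalKer = ⊤`. The proof of part IX only USES ordinary isotropy above the primes of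
the GOOD level `n` (`GoodLevel W K n`: `Frob_q² ≠ 1` for `q ∈ n`), where the ordinary condition IS an isotropic line
(koly g13 `weilCupProduct_res_eq_zero_of_mem_ordinaryLocalKer`). This file restates the theorem with `hisoOrd` asked
per unipotent-admissible prime `q` with `FrobSqNeOneAt W 3 q` and above `q` only; everything else — (REC), Kummer and
transverse isotropy, (Stab), (J), (IsoBound), the conclusion = the binder `hSupply` VERBATIM — is as in part IX, whose
abstract lemma `exists_eigen_not_mem_of_jump` is reused. See part IX's module docstring for the route and for what
remains ((J) unsigned Poitou–Tate count; (Stab) transverse transport; (IsoBound) local).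

References: [cite: WZhang2014, §8.1, Lemma 8.2] [cite: McCallumLMS1991, Prop. 2.1 (p. 296), Lemma 5.3 with proof
(p. 303)] [cite: GrossLMS1991, §5 (5.1), Prop. 8.1] [cite: MilneADT2006, Ch. I, Thm. 4.10].
-/

noncomputable section

open scoped Classical

namespace Summit.BirchSwinnertonDyer.Rank1Residual.X11b.Three.Koly.ZhangSupply

open WeierstrassCurve NumberField IsDedekindDomain
  Literature.NumberTheory.EllipticCurves Literature.NumberTheory.EllipticCurves.ModularForms
  Literature.NumberTheory.GaloisRepresentations Module
open Summit.BirchSwinnertonDyer.Rank1Residual.X11b.Three.Koly.Method2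

variable (W : WeierstrassCurve ℚ) (K : Type) [Field K] [NumberField K]
variable [W.IsElliptic] [W.IsGloballyMinimal] (ι : K →+* ℂ) (c : K ≃ₐ[ℚ] K)
  [Module (ZMod 3) (V3 W K)]
  [∀ v : Place K, Module (ZMod 3)
    (galoisCohomology (((W.baseChange K).torsionGaloisModule ((3 ^ 1 : ℕ) : ℤ)).toLocal v) 1)]

/-- **The (Supply) binder, SIGNED, from the unsigned jump — ordinary isotropy asked only above GOOD unipotent-admissible
primes.** Data as in
`Method2.inductionOfLevelSystems_of_localGlobal`: the genuine localisations `loc` (`hloc`), the places `plK` of the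
Kolyvagin primes, bilinear local forms `b` with (REC) `hrec` and the isotropies `hisoKum` ∕ `hisoTr` (verbatim the
capstone's binders) and `hisoOrd` RESTRICTED to the places above unipotent-admissible `q` with `Frob_q² ≠ 1` on `E[3]`
(`FrobSqNeOneAt`; at such `q` the ordinary condition is a line, elsewhere it can be all of `H¹` — zhang3-p1 g9's finding
on p502470), and complex conjugation `c` with `c² = 1`. New hypotheses, for every good
non-empty level `n`, Kolyvagin prime `ℓ ∉ T`: (Stab) `hstab` — the relaxed group `G(n, ℓ, T)` (Kummer at `∞` and at
the finite `v ≠ λ` off `T` above no prime of `n`, ordinary above `n`, transverse on `T`, free at `λ = plK ℓ`) is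
`conjAct c`-stable; (J) `hjump` — for every `x₀` some `x ∈ G` has `loc_λ x ∉ ℤ · loc_λ x₀` (stated through
`torsionLocalKer_λ = ker loc_λ`); (IsoBound) `hbound` — at every Kolyvagin `λ` and sign `s`, two classes of sign `s`
whose localisations are mutually and self `b_λ`-orthogonal, the first with `loc_λ ≠ 0`, have proportional
localisations. CONCLUSION: the binder `hSupply` verbatim — for each sign a NON-ZERO class of that sign in `G`.
[cite: WZhang2014, Lemma 8.2] [cite: McCallumLMS1991, Prop. 2.1, Lemma 5.3] [cite: GrossLMS1991, Prop. 8.1] -/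
theorem supply_signed_of_jump_good (hc2 : c * c = 1)
    (loc : (v : Place K) → V3 W K →ₗ[ZMod 3]
      galoisCohomology (((W.baseChange K).torsionGaloisModule ((3 ^ 1 : ℕ) : ℤ)).toLocal v) 1)
    (hloc : ∀ (v : Place K) (x : V3 W K),
      loc v x = galoisCohomology.localization ((W.baseChange K).torsionGaloisModule ((3 ^ 1 : ℕ) : ℤ)) v 1 x)
    (plK : {ℓ // Zhang2014.IsKolyvaginPrime (W.conductorNorm ℤ) W K 3 ℓ} → HeightOneSpectrum (𝓞 K))
    (b : (v : Place K) →
      galoisCohomology (((W.baseChange K).torsionGaloisModule ((3 ^ 1 : ℕ) : ℤ)).toLocal v) 1 →ₗ[ZMod 3]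
      galoisCohomology (((W.baseChange K).torsionGaloisModule ((3 ^ 1 : ℕ) : ℤ)).toLocal v) 1 →ₗ[ZMod 3] ZMod 3)
    (hrec : ∀ (x y : V3 W K) (T : Finset (Place K)), (∀ v, v ∉ T → b v (loc v x) (loc v y) = 0) →
      ∑ v ∈ T, b v (loc v x) (loc v y) = 0)
    (hisoKum : ∀ (v : Place K),
      ∀ x ∈ (W.baseChange K).kummerLocalConditionAt ((3 ^ 1 : ℕ) : ℤ) (Place.Completion v),
      ∀ y ∈ (W.baseChange K).kummerLocalConditionAt ((3 ^ 1 : ℕ) : ℤ) (Place.Completion v), b v x y = 0)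
    -- ordinary isotropy is asked ONLY above GOOD unipotent-admissible primes (zhang3-p1 g9's repair of p502470)
    (hisoOrd : ∀ (q : {q // IsUAdmissiblePrime W K q}), FrobSqNeOneAt W 3 q.1 →
      ∀ (v : HeightOneSpectrum (𝓞 K)), ((q : ℕ) : 𝓞 K) ∈ v.asIdeal → ∀ (x y : V3 W K),
      x ∈ (W.baseChange K).ordinaryLocalKer (v.adicCompletion K) ((3 ^ 1 : ℕ) : ℤ) →
      y ∈ (W.baseChange K).ordinaryLocalKer (v.adicCompletion K) ((3 ^ 1 : ℕ) : ℤ) →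
      b (Sum.inr v) (loc (Sum.inr v) x) (loc (Sum.inr v) y) = 0)
    (hisoTr : ∀ (ℓ : {ℓ // Zhang2014.IsKolyvaginPrime (W.conductorNorm ℤ) W K 3 ℓ}) (x y : V3 W K),
      x ∈ transverseLocalKer W K ι ℓ (plK ℓ) → y ∈ transverseLocalKer W K ι ℓ (plK ℓ) →
      b (Sum.inr (plK ℓ)) (loc (Sum.inr (plK ℓ)) x) (loc (Sum.inr (plK ℓ)) y) = 0)
    -- (Stab): the relaxed group `G(n, ℓ, T)` is stable under complex conjugation
    (hstab : ∀ (n : Finset {q // IsUAdmissiblePrime W K q}), GoodLevel W K n → n.Nonempty →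
      ∀ (ℓ : {ℓ // Zhang2014.IsKolyvaginPrime (W.conductorNorm ℤ) W K 3 ℓ}) (T : Finset _), ℓ ∉ T →
      ∀ x : V3 W K,
        ((∀ w : InfinitePlace K, x ∈ selmerLocalKer (W.baseChange K) w.Completion ((3 ^ 1 : ℕ) : ℤ)) ∧
          (∀ v : HeightOneSpectrum (𝓞 K), v ≠ plK ℓ → (∀ ℓ' ∈ T, plK ℓ' ≠ v) →
            ((∀ q ∈ n, ((q : ℕ) : 𝓞 K) ∉ v.asIdeal) →
              x ∈ selmerLocalKer (W.baseChange K) (v.adicCompletion K) ((3 ^ 1 : ℕ) : ℤ)) ∧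
            (∀ q ∈ n, ((q : ℕ) : 𝓞 K) ∈ v.asIdeal →
              x ∈ (W.baseChange K).ordinaryLocalKer (v.adicCompletion K) ((3 ^ 1 : ℕ) : ℤ))) ∧
          (∀ ℓ' ∈ T, x ∈ transverseLocalKer W K ι ℓ' (plK ℓ'))) →
        ((∀ w : InfinitePlace K,
            conjAct W c ((3 ^ 1 : ℕ) : ℤ) x ∈ selmerLocalKer (W.baseChange K) w.Completion ((3 ^ 1 : ℕ) : ℤ)) ∧
          (∀ v : HeightOneSpectrum (𝓞 K), v ≠ plK ℓ → (∀ ℓ' ∈ T, plK ℓ' ≠ v) →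
            ((∀ q ∈ n, ((q : ℕ) : 𝓞 K) ∉ v.asIdeal) →
              conjAct W c ((3 ^ 1 : ℕ) : ℤ) x ∈
                selmerLocalKer (W.baseChange K) (v.adicCompletion K) ((3 ^ 1 : ℕ) : ℤ)) ∧
            (∀ q ∈ n, ((q : ℕ) : 𝓞 K) ∈ v.asIdeal →
              conjAct W c ((3 ^ 1 : ℕ) : ℤ) x ∈
                (W.baseChange K).ordinaryLocalKer (v.adicCompletion K) ((3 ^ 1 : ℕ) : ℤ))) ∧
          (∀ ℓ' ∈ T, conjAct W c ((3 ^ 1 : ℕ) : ℤ) x ∈ transverseLocalKer W K ι ℓ' (plK ℓ'))))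
    -- (J): the image of `G(n, ℓ, T)` at `λ` is not contained in a line
    (hjump : ∀ (n : Finset {q // IsUAdmissiblePrime W K q}), GoodLevel W K n → n.Nonempty →
      ∀ (ℓ : {ℓ // Zhang2014.IsKolyvaginPrime (W.conductorNorm ℤ) W K 3 ℓ}) (T : Finset _), ℓ ∉ T →
      ∀ x₀ : V3 W K, ∃ x : V3 W K,
        ((∀ w : InfinitePlace K, x ∈ selmerLocalKer (W.baseChange K) w.Completion ((3 ^ 1 : ℕ) : ℤ)) ∧
          (∀ v : HeightOneSpectrum (𝓞 K), v ≠ plK ℓ → (∀ ℓ' ∈ T, plK ℓ' ≠ v) →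
            ((∀ q ∈ n, ((q : ℕ) : 𝓞 K) ∉ v.asIdeal) →
              x ∈ selmerLocalKer (W.baseChange K) (v.adicCompletion K) ((3 ^ 1 : ℕ) : ℤ)) ∧
            (∀ q ∈ n, ((q : ℕ) : 𝓞 K) ∈ v.asIdeal →
              x ∈ (W.baseChange K).ordinaryLocalKer (v.adicCompletion K) ((3 ^ 1 : ℕ) : ℤ))) ∧
          (∀ ℓ' ∈ T, x ∈ transverseLocalKer W K ι ℓ' (plK ℓ'))) ∧
        ∀ a : ℤ, x - a • x₀ ∉ (W.baseChange K).torsionLocalKer ((plK ℓ).adicCompletion K) ((3 ^ 1 : ℕ) : ℤ))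
    -- (IsoBound): at a Kolyvagin prime, mutually isotropic localisations of one sign are proportional
    (hbound : ∀ (ℓ : {ℓ // Zhang2014.IsKolyvaginPrime (W.conductorNorm ℤ) W K 3 ℓ}) (s : Bool) (x y : V3 W K),
      conjAct W c ((3 ^ 1 : ℕ) : ℤ) x = sgn s • x → conjAct W c ((3 ^ 1 : ℕ) : ℤ) y = sgn s • y →
      b (Sum.inr (plK ℓ)) (loc (Sum.inr (plK ℓ)) x) (loc (Sum.inr (plK ℓ)) x) = 0 →
      b (Sum.inr (plK ℓ)) (loc (Sum.inr (plK ℓ)) x) (loc (Sum.inr (plK ℓ)) y) = 0 →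
      b (Sum.inr (plK ℓ)) (loc (Sum.inr (plK ℓ)) y) (loc (Sum.inr (plK ℓ)) x) = 0 →
      b (Sum.inr (plK ℓ)) (loc (Sum.inr (plK ℓ)) y) (loc (Sum.inr (plK ℓ)) y) = 0 →
      x ∉ (W.baseChange K).torsionLocalKer ((plK ℓ).adicCompletion K) ((3 ^ 1 : ℕ) : ℤ) →
      ∃ a : ℤ, y - a • x ∈ (W.baseChange K).torsionLocalKer ((plK ℓ).adicCompletion K) ((3 ^ 1 : ℕ) : ℤ)) :
    ∀ (n : Finset {q // IsUAdmissiblePrime W K q}), GoodLevel W K n → n.Nonempty →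
      ∀ (ℓ : {ℓ // Zhang2014.IsKolyvaginPrime (W.conductorNorm ℤ) W K 3 ℓ}) (T : Finset _), ℓ ∉ T →
      ∀ s : Bool, ∃ x : V3 W K, conjAct W c ((3 ^ 1 : ℕ) : ℤ) x = sgn s • x ∧ x ≠ 0 ∧
        (∀ w : InfinitePlace K, x ∈ selmerLocalKer (W.baseChange K) w.Completion ((3 ^ 1 : ℕ) : ℤ)) ∧
        (∀ v : HeightOneSpectrum (𝓞 K), v ≠ plK ℓ → (∀ ℓ' ∈ T, plK ℓ' ≠ v) →
          ((∀ q ∈ n, ((q : ℕ) : 𝓞 K) ∉ v.asIdeal) →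
            x ∈ selmerLocalKer (W.baseChange K) (v.adicCompletion K) ((3 ^ 1 : ℕ) : ℤ)) ∧
          (∀ q ∈ n, ((q : ℕ) : 𝓞 K) ∈ v.asIdeal →
            x ∈ (W.baseChange K).ordinaryLocalKer (v.adicCompletion K) ((3 ^ 1 : ℕ) : ℤ))) ∧
        (∀ ℓ' ∈ T, x ∈ transverseLocalKer W K ι ℓ' (plK ℓ')) := by
  intro n hg hn ℓ T hℓT s
  -- the relaxed group `G = G(n, ℓ, T)` as a subgroup of `H¹(K, E[3])`
  let G : AddSubgroup (V3 W K) :=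
    { carrier := {x | (∀ w : InfinitePlace K, x ∈ selmerLocalKer (W.baseChange K) w.Completion ((3 ^ 1 : ℕ) : ℤ)) ∧
        (∀ v : HeightOneSpectrum (𝓞 K), v ≠ plK ℓ → (∀ ℓ' ∈ T, plK ℓ' ≠ v) →
          ((∀ q ∈ n, ((q : ℕ) : 𝓞 K) ∉ v.asIdeal) →
            x ∈ selmerLocalKer (W.baseChange K) (v.adicCompletion K) ((3 ^ 1 : ℕ) : ℤ)) ∧
          (∀ q ∈ n, ((q : ℕ) : 𝓞 K) ∈ v.asIdeal →
            x ∈ (W.baseChange K).ordinaryLocalKer (v.adicCompletion K) ((3 ^ 1 : ℕ) : ℤ))) ∧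
        (∀ ℓ' ∈ T, x ∈ transverseLocalKer W K ι ℓ' (plK ℓ'))}
      add_mem' := fun {x y} hx hy ↦
        ⟨fun w ↦ add_mem (hx.1 w) (hy.1 w),
          fun v hv hvT ↦ ⟨fun hq ↦ add_mem ((hx.2.1 v hv hvT).1 hq) ((hy.2.1 v hv hvT).1 hq),
            fun q hq hqv ↦ add_mem ((hx.2.1 v hv hvT).2 q hq hqv) ((hy.2.1 v hv hvT).2 q hq hqv)⟩,
          fun ℓ' hℓ' ↦ add_mem (hx.2.2 ℓ' hℓ') (hy.2.2 ℓ' hℓ')⟩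
      zero_mem' :=
        ⟨fun w ↦ zero_mem _, fun v _ _ ↦ ⟨fun _ ↦ zero_mem _, fun _ _ _ ↦ zero_mem _⟩, fun _ _ ↦ zero_mem _⟩
      neg_mem' := fun {x} hx ↦
        ⟨fun w ↦ neg_mem (hx.1 w),
          fun v hv hvT ↦ ⟨fun hq ↦ neg_mem ((hx.2.1 v hv hvT).1 hq),
            fun q hq hqv ↦ neg_mem ((hx.2.1 v hv hvT).2 q hq hqv)⟩,
          fun ℓ' hℓ' ↦ neg_mem (hx.2.2 ℓ' hℓ')⟩ }
  -- the strict subgroup at `λ` (= `ker loc_λ`) and the Kummer dictionary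
  set Z := (W.baseChange K).torsionLocalKer ((plK ℓ).adicCompletion K) ((3 ^ 1 : ℕ) : ℤ) with hZdef
  have hZero : ∀ x : V3 W K, x ∈ Z ↔ loc (Sum.inr (plK ℓ)) x = 0 := by
    intro x; rw [hloc]; exact mem_torsionLocalKer_iff_localization_eq_zero W K (plK ℓ) x
  have hKumFin : ∀ (v : HeightOneSpectrum (𝓞 K)) (x : V3 W K),
      x ∈ selmerLocalKer (W.baseChange K) (v.adicCompletion K) ((3 ^ 1 : ℕ) : ℤ) →
        loc (Sum.inr v) x ∈
          (W.baseChange K).kummerLocalConditionAt ((3 ^ 1 : ℕ) : ℤ) (Place.Completion (Sum.inr v : Place K)) := by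
    intro v x hx; rw [hloc]; exact (mem_selmerLocalKer_iff_localization_mem_kummer W K v x).mp hx
  have hKumInf : ∀ (w : InfinitePlace K) (x : V3 W K),
      x ∈ selmerLocalKer (W.baseChange K) w.Completion ((3 ^ 1 : ℕ) : ℤ) →
        loc (Sum.inl w) x ∈
          (W.baseChange K).kummerLocalConditionAt ((3 ^ 1 : ℕ) : ℤ) (Place.Completion (Sum.inl w : Place K)) := by
    intro w x hx; rw [hloc]; exact (mem_selmerLocalKer_iff_localization_mem_kummer_inf W K w x).mp hx
  -- (orth): `loc_λ(G)` is isotropic — reciprocity with all terms off `λ` vanishing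
  have horth : ∀ x y : V3 W K, x ∈ G → y ∈ G →
      b (Sum.inr (plK ℓ)) (loc (Sum.inr (plK ℓ)) x) (loc (Sum.inr (plK ℓ)) y) = 0 := by
    intro x y hx hy
    have h := hrec x y {(Sum.inr (plK ℓ) : Place K)} fun v hv ↦ ?_
    · rwa [Finset.sum_singleton] at h
    have hv' : v ≠ Sum.inr (plK ℓ) := fun h ↦ hv (Finset.mem_singleton.mpr h)
    rcases v with w | v
    · exact hisoKum (Sum.inl w) _ (hKumInf w x (hx.1 w)) _ (hKumInf w y (hy.1 w))
    · have hvℓ : v ≠ plK ℓ := fun h ↦ hv' (by rw [h])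
      by_cases hvT : ∃ ℓ' ∈ T, plK ℓ' = v
      · obtain ⟨ℓ', hℓ'T, rfl⟩ := hvT
        exact hisoTr ℓ' x y (hx.2.2 ℓ' hℓ'T) (hy.2.2 ℓ' hℓ'T)
      · push Not at hvT
        by_cases hq : ∃ q ∈ n, ((q : ℕ) : 𝓞 K) ∈ v.asIdeal
        · obtain ⟨q, hq, hqv⟩ := hq
          exact hisoOrd q (hg q hq) v hqv x y ((hx.2.1 v hvℓ hvT).2 q hq hqv) ((hy.2.1 v hvℓ hvT).2 q hq hqv)
        · push Not at hq
          exact hisoKum (Sum.inr v) _ (hKumFin v x ((hx.2.1 v hvℓ hvT).1 hq)) _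
            (hKumFin v y ((hy.2.1 v hvℓ hvT).1 hq))
  -- (dec): eigen-decomposition inside the `conjAct`-stable subgroup `G` (`3` odd, `c² = 1`)
  have h3 : ∀ a : V3 W K, 3 • a = 0 := fun a ↦ by
    rw [← Nat.cast_smul_eq_nsmul (ZMod 3), ZMod.natCast_self, zero_smul]
  have hτ : ∀ a : V3 W K, conjAct W c ((3 ^ 1 : ℕ) : ℤ) (conjAct W c ((3 ^ 1 : ℕ) : ℤ) a) = a :=
    fun a ↦ conjAct_conjAct_of_mul_self W hc2 _ a
  have hG : ∀ a ∈ G, conjAct W c ((3 ^ 1 : ℕ) : ℤ) a ∈ G := fun a ha ↦ hstab n hg hn ℓ T hℓT a ha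
  have hsgn : sgn s = 1 ∨ sgn s = -1 := by cases s <;> simp [sgn]
  have hsgn' : sgn (!s) = -sgn s := by cases s <;> rfl
  have hdec : ∀ x, x ∈ G → ∃ y z, y ∈ G ∧ conjAct W c ((3 ^ 1 : ℕ) : ℤ) y = sgn s • y ∧ z ∈ G ∧
      conjAct W c ((3 ^ 1 : ℕ) : ℤ) z = sgn (!s) • z ∧ x = y + z := by
    intro x hx
    obtain ⟨y, hy, z, hz, hyτ, hzτ, hxyz⟩ :=
      exists_eigen_decomposition (n := 3) (by decide) h3 (conjAct W c ((3 ^ 1 : ℕ) : ℤ)) hτ hsgn G hG hx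
    exact ⟨y, z, hy, hyτ, hz, by rw [hsgn']; exact hzτ, hxyz⟩
  -- assemble
  obtain ⟨x, hxG, hxE, hxZ⟩ := exists_eigen_not_mem_of_jump Z (· ∈ G)
    (fun s' x ↦ conjAct W c ((3 ^ 1 : ℕ) : ℤ) x = sgn s' • x)
    (fun x y ↦ b (Sum.inr (plK ℓ)) (loc (Sum.inr (plK ℓ)) x) (loc (Sum.inr (plK ℓ)) y) = 0) s hdec horth
    (fun x₀ ↦ hjump n hg hn ℓ T hℓT x₀) (fun x y hx hy ↦ hbound ℓ (!s) x y hx hy)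
  refine ⟨x, hxE, fun h0 ↦ hxZ (h0 ▸ zero_mem Z), hxG.1, hxG.2.1, hxG.2.2⟩

end Summit.BirchSwinnertonDyer.Rank1Residual.X11b.Three.Koly.ZhangSupply

end
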